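import Summits.QuantumAdvantage.QuantumAdvantage.Theses.YangBaxterIslands
import Literature.Computability.Complexity.ScaledPCPAssembly
import Literature.Computability.MetaComplexity.AvgCaseDerandomizationPCP

/-!
# Birth skeleton of piece `YbEHard` (E needs 2^{εn}-size circuits at ALL large n) — per-piece skeleton for the split of `YbTarget`

HONEST STATUS. `YbEHard` is the ROOT HYPOTHESIS of hardness-vs-randomness (Impagliazzo–Wigderson 1997, Thm 2;
Arora–Barak Thm 20.7: "the reasonable assumption"). No proof technique for exponential circuit lower bounds in `E`
is in print (natural proofs; relativized worlds with small circuits for `E`, Wilson 1985). This skeleton is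
therefore a POSITION CERTIFICATE, typed over the tree, for grounders/refuters — not a proof plan:

  stub_ioHard  : some `L ∈ E` is `2^{εn}`-hard INFINITELY OFTEN (`∃ᶠ n`) — the form every known lower-bound
                 technique (diagonalization, the algorithmic method) produces; open for `E` and general circuits.
  stub_ioToAe  : i.o. exponential hardness in `E` upgrades to ALMOST-EVERYWHERE exponential hardness in `E` — the
                 separate, notorious `i.o./a.e.` obstacle (cf. Chen–Lyu–Williams FOCS 2020, a.e. lower bounds for
                 `E^NP` against restricted classes by a dedicated technique). A bridge stub (T → C) with T substantive.
  YbEHard_of   : stub_ioHard → stub_ioToAe → YbEHard   (modus ponens; the two named difficulties are the content).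

PROVED REMARK (0 sorry): `YbEHard_of_heuristica : DistNP ⊆ AvgP → YbEHard` — the ONE sufficient condition of a
different kind in print (Buhrman–Fortnow–Pavan 2005 Thm 3.1 with Thm 3.3), fully discharged in the tree
(`ScaledPCP.exists_pcp_of_mem_E` + `exists_hard_E_of_DistNP_subset_AvgP_of_pcp`); its antecedent ("NP is easy on
average", Impagliazzo's Heuristica-or-better) is widely DISBELIEVED, so it is recorded, not offered as a stub.
-/

namespace Summit.QuantumAdvantage.QuantumAdvantage.Cruxes.YbTarget.BirthEHard

/-- the piece (local copy; becomes the route decl `YangBaxterIslands.YbEHard` after the split) -/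
def YbEHard : Prop :=
  ∃ L ∈ Literature.Computability.Complexity.E, ∃ ε : ℝ, 0 < ε ∧ ∀ᶠ n : ℕ in Filter.atTop, (2 : ℝ) ^ (ε * n) ≤ (L.circuitSize n : ℝ)

/-- STUB `stub_ioHard`: `E ⊄ SIZE(2^{εn})` in the INFINITELY-OFTEN form — some `L ∈ E`, `ε > 0` with
`2^{εn} ≤ circuitSize(L, n)` for infinitely many `n`. Strictly weaker than the piece; open. -/
theorem stub_ioHard : ∃ L ∈ Literature.Computability.Complexity.E, ∃ ε : ℝ, 0 < ε ∧ ∃ᶠ n : ℕ in Filter.atTop, (2 : ℝ) ^ (ε * n) ≤ (L.circuitSize n : ℝ) := by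
  sorry

/-- STUB `stub_ioToAe` (bridge; the i.o./a.e. upgrade inside `E` at exponential size): if some `E`-language is
`2^{εn}`-hard infinitely often then some `E`-language is `2^{ε'n}`-hard at all large `n`. Open; implied by the
piece; no padding/condensing argument achieving it is known. -/
theorem stub_ioToAe : (∃ L ∈ Literature.Computability.Complexity.E, ∃ ε : ℝ, 0 < ε ∧ ∃ᶠ n : ℕ in Filter.atTop, (2 : ℝ) ^ (ε * n) ≤ (L.circuitSize n : ℝ)) → (∃ L ∈ Literature.Computability.Complexity.E, ∃ ε : ℝ, 0 < ε ∧ ∀ᶠ n : ℕ in Filter.atTop, (2 : ℝ) ^ (ε * n) ≤ (L.circuitSize n : ℝ)) := by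
  sorry

/-- COMPOSITION (no sorry). -/
theorem YbEHard_of :
    (∃ L ∈ Literature.Computability.Complexity.E, ∃ ε : ℝ, 0 < ε ∧ ∃ᶠ n : ℕ in Filter.atTop, (2 : ℝ) ^ (ε * n) ≤ (L.circuitSize n : ℝ)) →
    ((∃ L ∈ Literature.Computability.Complexity.E, ∃ ε : ℝ, 0 < ε ∧ ∃ᶠ n : ℕ in Filter.atTop, (2 : ℝ) ^ (ε * n) ≤ (L.circuitSize n : ℝ)) → (∃ L ∈ Literature.Computability.Complexity.E, ∃ ε : ℝ, 0 < ε ∧ ∀ᶠ n : ℕ in Filter.atTop, (2 : ℝ) ^ (ε * n) ≤ (L.circuitSize n : ℝ))) →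
    YbEHard :=
  fun h₁ h₂ => h₂ h₁

theorem YbEHard_of_stubs : YbEHard := YbEHard_of stub_ioHard stub_ioToAe

/-- PROVED REMARK: Heuristica gives the piece (Buhrman–Fortnow–Pavan 2005; every link a tree theorem). -/
theorem YbEHard_of_heuristica (hD : Literature.Computability.MetaComplexity.DistNP ⊆ Literature.Computability.MetaComplexity.AvgP) : YbEHard :=
  Literature.Computability.MetaComplexity.exists_hard_E_of_DistNP_subset_AvgP_of_pcp
    Literature.Computability.Complexity.ScaledPCP.exists_pcp_of_mem_E hD

/-- PROVED REMARK: the piece is necessary-in-kind for its use: it is exactly the antecedent of the tree's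
`impagliazzo_wigderson` and yields `P = BPP`. -/
theorem PeqBPP_of_YbEHard (h : YbEHard) :
    Literature.Computability.Complexity.Classes.P = Literature.Computability.Complexity.BPP :=
  Literature.Computability.Complexity.impagliazzo_wigderson_holds h

end Summit.QuantumAdvantage.QuantumAdvantage.Cruxes.YbTarget.BirthEHard
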